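import Summits.NavierStokesRegularity.NavierStokesRegularity.Theorems.LerayQuarterDissipationFiniteDissipationLiouvilleTraceRotationalTools
import HarnessLib

/-!
# Crux `FiniteDissipationLiouville` (stmt-NavierStokesRegularity-22144): THE FINAL DATUM OF A
# NONZERO MEMBER OF THE STRATUM IS ROTATIONAL IN EVERY HALF-SPACE AND AT THE APEX — backward
# uniqueness from an IRROTATIONAL far field of the trace; ε-regularity by the trace's vorticity

Theorems file of route `LerayQuarterDissipation` (lead prover g6; `--supports` the crux; file 2/2
of the rotational-trace leaf, portrait fact for the registered stub `stub_envelopeCriticalLiouville`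
of skeleton v9; tools in `…TraceRotationalTools`). Navier–Stokes regularity is NOT proved by
anything here; no summit is.

`𝒟_{C,K}`: Type-I ancient mild fields `u` (`IsTypeIAncientMild C u`) with the quarter-rate law;
`T_u(ψ) = lim_{t→0⁻} ∫⟪u(t), ψ⟫` the distributional trace at the singular time (lead g3). Lead g5
proved (`…TraceHalfSpace`, Lemarié-Rieusset Thm. 15.4 on a half-space): trace VANISHING on a
half-space ⇒ `u ≡ 0`. Escauriaza–Seregin–Šverák's backward uniqueness for the vorticity equation
(Thm. 5.1) needs only the VORTICITY to vanish at the final time (far-field step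
`farField_curl_eq_zero_halfSpace_of_vorticity_top`, this lead, Literature p618070). Hence:

* `eq_zero_of_trace_irrotational_halfSpace` — **trace IRROTATIONAL on an open half-space
  `{⟪x, e⟫ > R₁}` (`‖e‖ = 1`; `∫⟪u(t), ∇ ∧ ψ⟫ → 0` for the test fields `ψ` supported there) ⇒
  `u ≡ 0` on `t < 0`**: far-field regularity through the apex with bounds + ESŠ give
  `∇ ∧ u(t,·) = 0` on a farther half-space for `t ∈ (-1,0)` (`…TraceRotationalTools`); the slices
  are REAL-ANALYTIC (`IsTypeIAncientMild.analyticOnNhd_slice_univ`), so `∇ ∧ u(t,·) ≡ 0`; an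
  irrotational divergence-free slice in `L⁶` vanishes (`QuietVorticity`); all `t < 0` by scaling
  (`integral_pairing_curl_nsRescale`). `eq_zero_of_trace_irrotational_farField`: outside a ball.
* `not_singular_of_trace_irrotational_near_apex` — **ε-REGULARITY BY THE VORTICITY OF THE FINAL
  DATUM: trace irrotational on a PUNCTURED BALL `B(0,r) ∖ {0}` around the apex ⇒ regular** (the
  blow-ups have traces irrotational on `B(0, r/λ) ∖ {0}`; a singular KNSS limit across members
  (p591803, persistence) would have trace irrotational on a whole half-space — trace continuity
  along the sequence, lead g3 — hence vanish).
* PORTRAIT (`exists_halfSpace_trace_curl_ne_zero_of_singular`, `exists_apex_trace_curl_ne_zero_of_singular`):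
  **the final datum of every SINGULAR member (past-DSS or past-wandering) has NONZERO VORTICITY
  in every open half-space in every direction AND in every punctured ball around the apex** — the
  singularity radiates vorticity to spatial infinity in all directions and concentrates it at the
  apex at the final time; for the DSS wall: the homogeneous datum `a(x̂)‖x‖⁻¹` is a potential flow
  on no open cone. Strictly stronger than g5's half-space leaf (vanishing ⊊ irrotational).
* `finiteDissipationLiouville_iff_rotationalTrace` — the crux ⟺ its restriction to such members.
HONEST FRAMING: portrait facts; no DSS scenario of the catalogued wall is removed. References:
ESŠ, Russ. Math. Surveys 58 (2003), Thm. 5.1; Lemarié-Rieusset (2016), Thm. 15.4; KNSS 2009, §4.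
-/

noncomputable section

-- the summit and its single sub-problem share the name (CONVENTIONS §1), as in every Theorems file
set_option linter.dupNamespace false

namespace Summit.NavierStokesRegularity.NavierStokesRegularity.Theorems.FiniteDissipationLiouville.Birth.Apex

open MeasureTheory Set Filter Topology Metric Function TopologicalSpace
open Literature.Analysis Literature.Analysis.FluidPDE
open scoped ENNReal NNReal RealInnerProductSpace

variable {C K : ℝ} {u : ℝ → EuclideanSpace ℝ (Fin 3) → EuclideanSpace ℝ (Fin 3)}

/-! ### The leaf: an irrotational far field of the trace forces triviality -/

/-- **Core (window `(-1, 0)`).** If the trace of `u ∈ 𝒟_{C,K}` is irrotational on the half-space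
`{⟪x, e⟫ > R₁}`, then `u(t, ·) ≡ 0` for every `t ∈ (-1, 0)` (far-field vorticity zero, analytic
continuation, harmonic Liouville in `L⁶`). -/
theorem slice_eq_zero_Ioo_of_trace_irrotational_halfSpace (hu : IsTypeIAncientMild C u)
    (hlaw : ∀ s : ℝ, s < 0 → ∫⁻ x, ‖fderiv ℝ (u s) x‖ₑ ^ 2 ≤ ENNReal.ofReal (K / Real.sqrt (-s)))
    {e : EuclideanSpace ℝ (Fin 3)} (he : ‖e‖ = 1) {R₁ : ℝ}
    (hirr : ∀ ψ : EuclideanSpace ℝ (Fin 3) → EuclideanSpace ℝ (Fin 3),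
      FunctionSpaces.IsTestFunctionOn (⊤ : Opens (EuclideanSpace ℝ (Fin 3))) ψ →
        (∀ x, ψ x ≠ 0 → R₁ < ⟪x, e⟫) →
        Tendsto (fun t => ∫ x, ⟪u t x, curl ψ x⟫) (𝓝[<] 0) (𝓝 0)) :
    ∀ t ∈ Ioo (-1 : ℝ) 0, ∀ x, u t x = 0 := by
  obtain ⟨R, hR⟩ := exists_farField_curl_eq_zero_of_trace_irrotational hu hlaw he hirr
  intro t ht
  -- the vorticity of the slice vanishes on the ball `B((R+2)e, 1) ⊆ {⟪x, e⟫ > R}`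
  set x₀ : EuclideanSpace ℝ (Fin 3) := (R + 2) • e with hx₀
  refine slice_eq_zero_of_curl_eq_zero_near hu hlaw ht.2 (x₀ := x₀) one_pos fun x hx => hR t ht x ?_
  have hx₀e : ⟪x₀, e⟫ = R + 2 := by
    rw [hx₀, real_inner_smul_left, real_inner_self_eq_norm_sq, he]; ring
  have hdiff : ⟪x - x₀, e⟫ ≤ ‖x - x₀‖ := inner_le_norm_of_unit he _
  have hdist : ‖x - x₀‖ < 1 := by rwa [mem_ball, dist_eq_norm] at hx
  have : ⟪x, e⟫ = ⟪x - x₀, e⟫ + ⟪x₀, e⟫ := by rw [← inner_add_left, sub_add_cancel]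
  rw [this, hx₀e]
  have habs := abs_real_inner_le_norm (x - x₀) e
  rw [he, mul_one] at habs
  have := neg_abs_le ⟪x - x₀, e⟫
  linarith

/-- **The curl pairing under the Navier–Stokes dilation**: for `λ > 0` and the dilated test
field `ψ_λ = ψ(λ⁻¹ ·)` (whose curl is `λ⁻¹ (∇ ∧ ψ)(λ⁻¹ ·)`),
`∫⟪u_λ(t), ∇ ∧ ψ⟫ = λ⁻¹ ∫⟪u(λ²t), ∇ ∧ ψ_λ⟫` (substitution `x = λ y`). -/
theorem integral_pairing_curl_nsRescale (u : ℝ → EuclideanSpace ℝ (Fin 3) → EuclideanSpace ℝ (Fin 3))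
    {lam : ℝ} (hlam : 0 < lam) (ψ : EuclideanSpace ℝ (Fin 3) → EuclideanSpace ℝ (Fin 3)) (t : ℝ) :
    ∫ x, ⟪nsRescale lam u t x, curl ψ x⟫ =
      lam⁻¹ * ∫ y, ⟪u (lam ^ 2 * t) y, curl (fun x => ψ (lam⁻¹ • x)) y⟫ := by
  have hl0 : lam ≠ 0 := hlam.ne'
  -- `∇ ∧ ψ_λ (y) = λ⁻¹ (∇ ∧ ψ)(λ⁻¹ y)`
  have hcurl : ∀ y, curl (fun x => ψ (lam⁻¹ • x)) y = lam⁻¹ • curl ψ (lam⁻¹ • y) := fun y => by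
    rw [curl_eq_curlCLM, curl_eq_curlCLM, _root_.fderiv_comp_smul, map_smul]
  have h1 : (fun y => ⟪u (lam ^ 2 * t) y, curl (fun x => ψ (lam⁻¹ • x)) y⟫) =
      fun y => lam⁻¹ * (fun x => ⟪u (lam ^ 2 * t) (lam • x), curl ψ x⟫) (lam⁻¹ • y) := by
    funext y
    simp only [hcurl, real_inner_smul_right, smul_inv_smul₀ hl0]
  have h2 : (fun x => ⟪nsRescale lam u t x, curl ψ x⟫) =
      fun x => lam * ⟪u (lam ^ 2 * t) (lam • x), curl ψ x⟫ := by
    funext x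
    rw [nsRescale_apply, real_inner_smul_left]
  rw [h1, integral_const_mul, Measure.integral_comp_inv_smul volume
    (fun x => ⟪u (lam ^ 2 * t) (lam • x), curl ψ x⟫) lam, h2, integral_const_mul,
    finrank_euclideanSpace_fin, abs_of_pos (pow_pos hlam 3), smul_eq_mul]
  field_simp

/-- The time change `t ↦ λ² t` (`λ > 0`) preserves `𝓝[<] 0`. -/
theorem tendsto_mul_sq_nhdsWithin_zero {lam : ℝ} (hlam : 0 < lam) :
    Tendsto (fun t : ℝ => lam ^ 2 * t) (𝓝[<] 0) (𝓝[<] 0) := by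
  refine tendsto_nhdsWithin_of_tendsto_nhds_of_eventually_within _ ?_ ?_
  · have hc : Continuous fun t : ℝ => lam ^ 2 * t := continuous_const.mul continuous_id
    have h : Tendsto (fun t : ℝ => lam ^ 2 * t) (𝓝 (0 : ℝ)) (𝓝 (lam ^ 2 * 0)) := hc.tendsto 0
    rw [mul_zero] at h
    exact h.mono_left nhdsWithin_le_nhds
  · filter_upwards [self_mem_nhdsWithin] with t ht
    show lam ^ 2 * t < 0
    exact mul_neg_of_pos_of_neg (pow_pos hlam 2) ht

/-- The Navier–Stokes dilation transports the irrotational-trace hypothesis: if the trace of `u`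
is irrotational on `{⟪x, e⟫ > R₁}`, that of `u_λ = nsRescale λ u` (`λ > 0`) is irrotational on
`{⟪x, e⟫ > R₁/λ}`. -/
theorem trace_irrotational_nsRescale {e : EuclideanSpace ℝ (Fin 3)} {R₁ lam : ℝ} (hlam : 0 < lam)
    (hirr : ∀ ψ : EuclideanSpace ℝ (Fin 3) → EuclideanSpace ℝ (Fin 3),
      FunctionSpaces.IsTestFunctionOn (⊤ : Opens (EuclideanSpace ℝ (Fin 3))) ψ →
        (∀ x, ψ x ≠ 0 → R₁ < ⟪x, e⟫) →
        Tendsto (fun t => ∫ x, ⟪u t x, curl ψ x⟫) (𝓝[<] 0) (𝓝 0)) :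
    ∀ ψ : EuclideanSpace ℝ (Fin 3) → EuclideanSpace ℝ (Fin 3),
      FunctionSpaces.IsTestFunctionOn (⊤ : Opens (EuclideanSpace ℝ (Fin 3))) ψ →
        (∀ x, ψ x ≠ 0 → R₁ / lam < ⟪x, e⟫) →
        Tendsto (fun t => ∫ x, ⟪nsRescale lam u t x, curl ψ x⟫) (𝓝[<] 0) (𝓝 0) := by
  intro ψ hψ hsupp
  have hl0 : lam ≠ 0 := hlam.ne'
  -- the dilated test field `ψ_λ = ψ(λ⁻¹ ·)`, supported in `{⟪x, e⟫ > R₁}`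
  have hψlt : FunctionSpaces.IsTestFunctionOn (⊤ : Opens (EuclideanSpace ℝ (Fin 3)))
      (fun x => ψ (lam⁻¹ • x)) := hψ.comp_smul_top (inv_ne_zero hl0)
  have hψlsupp : ∀ x, ψ (lam⁻¹ • x) ≠ 0 → R₁ < ⟪x, e⟫ := fun x hx => by
    have h := hsupp _ hx
    rw [real_inner_smul_left, div_lt_iff₀ hlam] at h
    have : lam⁻¹ * ⟪x, e⟫ * lam = ⟪x, e⟫ := by field_simp
    linarith [this]
  have hlim : Tendsto (fun t => lam⁻¹ * ∫ y, ⟪u (lam ^ 2 * t) y, curl (fun x => ψ (lam⁻¹ • x)) y⟫)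
      (𝓝[<] 0) (𝓝 0) := by
    have h := ((hirr _ hψlt hψlsupp).comp (tendsto_mul_sq_nhdsWithin_zero hlam)).const_mul lam⁻¹
    rw [mul_zero] at h
    exact h
  exact hlim.congr fun t => (integral_pairing_curl_nsRescale u hlam ψ t).symm

/-- **THE ROTATIONAL-TRACE LEAF.** A member of the finite-dissipation stratum `𝒟_{C,K}` whose
distributional trace at the singular time is IRROTATIONAL on some open half-space
`{⟪x, e⟫ > R₁}` (`‖e‖ = 1`) — `∫⟪u(t), ∇ ∧ ψ⟫ → 0` as `t → 0⁻` for every test field `ψ` supported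
there — vanishes identically on `t < 0`. [cite: EscauriazaSereginSverak2003, Thm. 5.1] -/
theorem eq_zero_of_trace_irrotational_halfSpace (hu : IsTypeIAncientMild C u)
    (hlaw : ∀ s : ℝ, s < 0 → ∫⁻ x, ‖fderiv ℝ (u s) x‖ₑ ^ 2 ≤ ENNReal.ofReal (K / Real.sqrt (-s)))
    {e : EuclideanSpace ℝ (Fin 3)} (he : ‖e‖ = 1) {R₁ : ℝ}
    (hirr : ∀ ψ : EuclideanSpace ℝ (Fin 3) → EuclideanSpace ℝ (Fin 3),
      FunctionSpaces.IsTestFunctionOn (⊤ : Opens (EuclideanSpace ℝ (Fin 3))) ψ →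
        (∀ x, ψ x ≠ 0 → R₁ < ⟪x, e⟫) →
        Tendsto (fun t => ∫ x, ⟪u t x, curl ψ x⟫) (𝓝[<] 0) (𝓝 0)) :
    ∀ t < 0, ∀ x, u t x = 0 := by
  intro t ht x
  -- dilate so that `t` lands in `(-1, 0)`: `λ² = -2t`, `u_λ(-1/2, ·) = λ u(t, λ ·)`
  set lam : ℝ := Real.sqrt (-2 * t) with hlam
  have hlam0 : 0 < lam := Real.sqrt_pos.2 (by linarith)
  have hlam2 : lam ^ 2 = -2 * t := Real.sq_sqrt (by linarith)
  have hz := slice_eq_zero_Ioo_of_trace_irrotational_halfSpace (hu.nsRescale hlam0)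
    (RecurrentReductionD.dissipationLaw_nsRescale hlaw hlam0) he (trace_irrotational_nsRescale hlam0 hirr)
    (-1 / 2) ⟨by norm_num, by norm_num⟩ (lam⁻¹ • x)
  rw [nsRescale_apply, smul_inv_smul₀ hlam0.ne', hlam2,
    show -2 * t * (-1 / 2 : ℝ) = t by ring] at hz
  rcases smul_eq_zero.1 hz with h | h
  · exact absurd h hlam0.ne'
  · exact h

/-- **The rotational-trace leaf, regularity form.** -/
theorem not_singular_of_trace_irrotational_halfSpace (hu : IsTypeIAncientMild C u)
    (hlaw : ∀ s : ℝ, s < 0 → ∫⁻ x, ‖fderiv ℝ (u s) x‖ₑ ^ 2 ≤ ENNReal.ofReal (K / Real.sqrt (-s)))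
    {e : EuclideanSpace ℝ (Fin 3)} (he : ‖e‖ = 1) {R₁ : ℝ}
    (hirr : ∀ ψ : EuclideanSpace ℝ (Fin 3) → EuclideanSpace ℝ (Fin 3),
      FunctionSpaces.IsTestFunctionOn (⊤ : Opens (EuclideanSpace ℝ (Fin 3))) ψ →
        (∀ x, ψ x ≠ 0 → R₁ < ⟪x, e⟫) →
        Tendsto (fun t => ∫ x, ⟪u t x, curl ψ x⟫) (𝓝[<] 0) (𝓝 0)) :
    ¬ (∀ r > 0, ∀ M : ℝ, ∃ t ∈ Set.Ioo (-(r ^ 2)) (0 : ℝ),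
        ∃ x ∈ Metric.ball (0 : EuclideanSpace ℝ (Fin 3)) r, M < ‖u t x‖) := by
  intro hsing
  obtain ⟨t, ht, x, -, hM⟩ := hsing 1 one_pos 0
  rw [eq_zero_of_trace_irrotational_halfSpace hu hlaw he hirr t ht.2 x, norm_zero] at hM
  exact lt_irrefl _ hM

/-! ### ε-regularity by the VORTICITY of the final datum near the apex -/

/-- **A member whose final datum is IRROTATIONAL ON A PUNCTURED BALL around the apex is regular at
the apex.** Hypothesis: `∫⟪u(t), ∇ ∧ ψ⟫ → 0` as `t → 0⁻` for every test field `ψ` supported in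
`B(0, r) ∖ {0}`. Proof: the blow-ups `u_λ`, `λ → 0⁺`, have traces irrotational on
`B(0, r/λ) ∖ {0}`; by KNSS compactness across members (p591803) and persistence of the apex
singularity a SINGULAR limit member `W` would have trace irrotational on the whole half-space
`{⟪x, e⟫ > 1}` (trace continuity along the sequence, lead g3), hence `W ≡ 0` by
`eq_zero_of_trace_irrotational_halfSpace` — contradiction. **So the final-time vorticity of a
singular member accumulates AT the apex.** -/
theorem not_singular_of_trace_irrotational_near_apex (hu : IsTypeIAncientMild C u)
    (hlaw : ∀ s : ℝ, s < 0 → ∫⁻ x, ‖fderiv ℝ (u s) x‖ₑ ^ 2 ≤ ENNReal.ofReal (K / Real.sqrt (-s)))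
    {r : ℝ} (hr : 0 < r)
    (hirr : ∀ ψ : EuclideanSpace ℝ (Fin 3) → EuclideanSpace ℝ (Fin 3),
      FunctionSpaces.IsTestFunctionOn (⊤ : Opens (EuclideanSpace ℝ (Fin 3))) ψ →
        (∀ x, ψ x ≠ 0 → x ≠ 0 ∧ ‖x‖ < r) →
        Tendsto (fun t => ∫ x, ⟪u t x, curl ψ x⟫) (𝓝[<] 0) (𝓝 0)) :
    ¬ (∀ r > 0, ∀ M : ℝ, ∃ t ∈ Set.Ioo (-(r ^ 2)) (0 : ℝ),
        ∃ x ∈ Metric.ball (0 : EuclideanSpace ℝ (Fin 3)) r, M < ‖u t x‖) := by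
  intro hsing
  -- ### the blow-up sequence `u_k = nsRescale λ_k u`, `λ_k = 1/(k+2)`
  set lam : ℕ → ℝ := fun k => 1 / ((k : ℝ) + 2) with hlam
  have hlam0 : ∀ k, 0 < lam k := fun k => by rw [hlam]; positivity
  have hlamt : Tendsto lam atTop (𝓝 0) :=
    tendsto_const_nhds.div_atTop (tendsto_atTop_add_const_right _ _ tendsto_natCast_atTop_atTop)
  set w : ℕ → ℝ → EuclideanSpace ℝ (Fin 3) → EuclideanSpace ℝ (Fin 3) :=
    fun k => nsRescale (lam k) u with hw
  have hwk : ∀ k, IsTypeIAncientMild C (w k) := fun k => hu.nsRescale (hlam0 k)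
  have hlawk : ∀ k, ∀ s : ℝ, s < 0 →
      ∫⁻ x, ‖fderiv ℝ (w k s) x‖ₑ ^ 2 ≤ ENNReal.ofReal (K / Real.sqrt (-s)) :=
    fun k => RecurrentReductionD.dissipationLaw_nsRescale hlaw (hlam0 k)
  have hsingk : ∀ k, ∀ r > 0, ∀ M : ℝ, ∃ t ∈ Ioo (-(r ^ 2)) (0 : ℝ),
      ∃ x ∈ ball (0 : EuclideanSpace ℝ (Fin 3)) r, M < ‖w k t x‖ :=
    fun k => RecurrentReductionD.singularAtOrigin_nsRescale hsing (hlam0 k)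
  -- ### KNSS compactness across members: a singular limit member `W ∈ 𝒟_{C,K}`
  obtain ⟨ψs, hψs, W, hW, hunif, hpt, hgrad⟩ := Compactness.seqLimit hwk
  have hψt : Tendsto ψs atTop atTop := hψs.tendsto_atTop
  have hWlaw : ∀ s : ℝ, s < 0 →
      ∫⁻ x, ‖fderiv ℝ (W s) x‖ₑ ^ 2 ≤ ENNReal.ofReal (K / Real.sqrt (-s)) :=
    Compactness.law_of_seqLimit (Kinf := K) (Kk := fun _ => K) hψt hlawk
      (fun ε hε => Eventually.of_forall fun _ => by linarith) hgrad
  have hWsing := Compactness.persistent_singularity_seq (w := fun j => w (ψs j))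
    (fun j => hwk (ψs j)) (fun j => hlawk (ψs j)) (fun j => hsingk (ψs j)) hW hunif
  -- ### the trace of `W` is irrotational on the half-space `{⟪x, e₀⟫ > 1}`
  set e₀ : EuclideanSpace ℝ (Fin 3) := EuclideanSpace.single 0 1 with he₀def
  have he₀ : ‖e₀‖ = 1 := by rw [he₀def]; simp
  have hWirr : ∀ ψ : EuclideanSpace ℝ (Fin 3) → EuclideanSpace ℝ (Fin 3),
      FunctionSpaces.IsTestFunctionOn (⊤ : Opens (EuclideanSpace ℝ (Fin 3))) ψ →
        (∀ x, ψ x ≠ 0 → 1 < ⟪x, e₀⟫) →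
        Tendsto (fun t => ∫ x, ⟪W t x, curl ψ x⟫) (𝓝[<] 0) (𝓝 0) := by
    intro ψ hψ hsupp
    have hψ1 : ContDiff ℝ ((⊤ : ℕ∞) + 1) ψ := by simpa using hψ.contDiff
    have hcψ : FunctionSpaces.IsTestFunctionOn (⊤ : Opens (EuclideanSpace ℝ (Fin 3))) (curl ψ) :=
      ⟨contDiff_curl hψ1, hasCompactSupport_curl hψ.hasCompactSupport, fun y _ => Opens.mem_top y⟩
    obtain ⟨L, hL⟩ := exists_tendsto_pairing_finalSlice hW hWlaw hcψ
    suffices hL0 : L = 0 by rwa [hL0] at hL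
    -- a radius `ρ` containing the support of `ψ`
    obtain ⟨ρ, hρ0, hρ⟩ : ∃ ρ > 0, ∀ x, ψ x ≠ 0 → ‖x‖ < ρ := by
      obtain ⟨ρ, hρ⟩ := (hψ.hasCompactSupport.isCompact.isBounded).subset_ball_lt 0 0
      exact ⟨ρ, hρ.1, fun x hx => by
        have h := hρ.2 (subset_tsupport _ (Function.mem_support.2 hx))
        rwa [mem_ball, dist_zero_right] at h⟩
    -- trace values of the blow-ups against `∇ ∧ ψ`
    have hex : ∀ j, ∃ Tj : ℝ, Tendsto (fun t => ∫ x, ⟪w (ψs j) t x, curl ψ x⟫) (𝓝[<] 0) (𝓝 Tj) :=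
      fun j => exists_tendsto_pairing_finalSlice (hwk (ψs j)) (hlawk (ψs j)) hcψ
    choose Tj hTj using hex
    have hconv : Tendsto Tj atTop (𝓝 L) :=
      tendsto_trace_of_tendsto_slices hcψ (fun j => hwk (ψs j)) (fun j => hlawk (ψs j)) hW hWlaw
        (fun t ht x => hpt t ht x) hTj hL
    -- eventually `λ ρ ≤ r`, and then the trace value is exactly `0`
    have hev : ∀ᶠ j in atTop, lam (ψs j) < r / ρ :=
      (hlamt.comp hψt).eventually (gt_mem_nhds (div_pos hr hρ0))
    have hzero : ∀ᶠ j in atTop, Tj j = 0 := by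
      filter_upwards [hev] with j hj
      have hl := hlam0 (ψs j)
      -- the hypothesis applies to the dilated field `ψ(λ⁻¹ ·)`, supported in `B(0, r) ∖ {0}`
      have hψlt : FunctionSpaces.IsTestFunctionOn (⊤ : Opens (EuclideanSpace ℝ (Fin 3)))
          (fun x => ψ ((lam (ψs j))⁻¹ • x)) := hψ.comp_smul_top (inv_ne_zero hl.ne')
      have hψlsupp : ∀ x, ψ ((lam (ψs j))⁻¹ • x) ≠ 0 → x ≠ 0 ∧ ‖x‖ < r := by
        intro x hx
        refine ⟨fun h0 => ?_, ?_⟩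
        · have h1 := hsupp _ hx
          rw [h0, smul_zero, inner_zero_left] at h1
          linarith
        · have h2 := hρ _ hx
          rw [norm_smul, norm_inv, Real.norm_of_nonneg hl.le, inv_mul_lt_iff₀ hl] at h2
          have h3 : lam (ψs j) * ρ < r := (lt_div_iff₀ hρ0).1 hj
          linarith
      have hlim : Tendsto (fun t => ∫ x, ⟪w (ψs j) t x, curl ψ x⟫) (𝓝[<] 0) (𝓝 0) := by
        have h := ((hirr _ hψlt hψlsupp).comp (tendsto_mul_sq_nhdsWithin_zero hl)).const_mul
          (lam (ψs j))⁻¹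
        rw [mul_zero] at h
        exact h.congr fun t => (integral_pairing_curl_nsRescale u hl ψ t).symm
      exact tendsto_nhds_unique (hTj j) hlim
    have hlim0 : Tendsto Tj atTop (𝓝 0) :=
      (tendsto_congr' hzero).2 tendsto_const_nhds
    exact tendsto_nhds_unique hconv hlim0
  -- ### contradiction: `W ≡ 0` yet singular
  have hWz := eq_zero_of_trace_irrotational_halfSpace hW hWlaw he₀ hWirr
  obtain ⟨t, ht, x, -, hM⟩ := hWsing 1 one_pos 0
  rw [hWz t ht.2 x, norm_zero] at hM
  exact lt_irrefl _ hM

/-- **Trace irrotational OUTSIDE A BALL ⇒ the member vanishes identically** (the exterior of a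
ball contains a half-space). -/
theorem eq_zero_of_trace_irrotational_farField (hu : IsTypeIAncientMild C u)
    (hlaw : ∀ s : ℝ, s < 0 → ∫⁻ x, ‖fderiv ℝ (u s) x‖ₑ ^ 2 ≤ ENNReal.ofReal (K / Real.sqrt (-s)))
    {R₁ : ℝ}
    (hirr : ∀ ψ : EuclideanSpace ℝ (Fin 3) → EuclideanSpace ℝ (Fin 3),
      FunctionSpaces.IsTestFunctionOn (⊤ : Opens (EuclideanSpace ℝ (Fin 3))) ψ →
        (∀ x, ψ x ≠ 0 → R₁ < ‖x‖) →
        Tendsto (fun t => ∫ x, ⟪u t x, curl ψ x⟫) (𝓝[<] 0) (𝓝 0)) :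
    ∀ t < 0, ∀ x, u t x = 0 := by
  set e₀ : EuclideanSpace ℝ (Fin 3) := EuclideanSpace.single 0 1 with he₀def
  have he₀ : ‖e₀‖ = 1 := by rw [he₀def]; simp
  refine eq_zero_of_trace_irrotational_halfSpace hu hlaw he₀ (R₁ := R₁) fun ψ hψ hsupp =>
    hirr ψ hψ fun x hx => lt_of_lt_of_le (hsupp x hx) (inner_le_norm_of_unit he₀ x)

/-! ### Portrait: the final datum of a nonzero member is rotational in every half-space -/

/-- **PORTRAIT ENTRY: the final datum of every NONZERO member of the stratum has NONZERO VORTICITY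
in every open half-space, in every direction**: for every unit vector `e` and every `R₁`, some test
field `ψ` supported in `{⟪x, e⟫ > R₁}` has trace value `T_u(∇ ∧ ψ) ≠ 0`. -/
theorem exists_halfSpace_trace_curl_ne_zero_of_ne_zero (hu : IsTypeIAncientMild C u)
    (hlaw : ∀ s : ℝ, s < 0 → ∫⁻ x, ‖fderiv ℝ (u s) x‖ₑ ^ 2 ≤ ENNReal.ofReal (K / Real.sqrt (-s)))
    (hne : ∃ t < 0, ∃ x, u t x ≠ 0) {e : EuclideanSpace ℝ (Fin 3)} (he : ‖e‖ = 1) (R₁ : ℝ) :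
    ∃ (ψ : EuclideanSpace ℝ (Fin 3) → EuclideanSpace ℝ (Fin 3)) (L : ℝ),
      FunctionSpaces.IsTestFunctionOn (⊤ : Opens (EuclideanSpace ℝ (Fin 3))) ψ ∧
        (∀ x, ψ x ≠ 0 → R₁ < ⟪x, e⟫) ∧
        Tendsto (fun t => ∫ x, ⟪u t x, curl ψ x⟫) (𝓝[<] 0) (𝓝 L) ∧ L ≠ 0 := by
  by_contra hno
  push Not at hno
  obtain ⟨t, ht, x, hx⟩ := hne
  refine hx (eq_zero_of_trace_irrotational_halfSpace hu hlaw he (R₁ := R₁) (fun ψ hψ hsupp => ?_) t ht x)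
  -- the trace value against the test field `∇ ∧ ψ` exists; by `hno` it is `0`
  have hψ1 : ContDiff ℝ ((⊤ : ℕ∞) + 1) ψ := by simpa using hψ.contDiff
  have hcψ : FunctionSpaces.IsTestFunctionOn (⊤ : Opens (EuclideanSpace ℝ (Fin 3))) (curl ψ) :=
    ⟨contDiff_curl hψ1, hasCompactSupport_curl hψ.hasCompactSupport, fun y _ => Opens.mem_top y⟩
  obtain ⟨L, hL⟩ := exists_tendsto_pairing_finalSlice hu hlaw hcψ
  have hL0 : L = 0 := hno ψ L hψ hsupp hL
  rwa [hL0] at hL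

/-- **PORTRAIT ENTRY (stub `stub_envelopeCriticalLiouville`): the final datum of every SINGULAR
member is rotational in every half-space.** -/
theorem exists_halfSpace_trace_curl_ne_zero_of_singular (hu : IsTypeIAncientMild C u)
    (hlaw : ∀ s : ℝ, s < 0 → ∫⁻ x, ‖fderiv ℝ (u s) x‖ₑ ^ 2 ≤ ENNReal.ofReal (K / Real.sqrt (-s)))
    (hsing : ∀ r > 0, ∀ M : ℝ, ∃ t ∈ Set.Ioo (-(r ^ 2)) (0 : ℝ),
        ∃ x ∈ Metric.ball (0 : EuclideanSpace ℝ (Fin 3)) r, M < ‖u t x‖)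
    {e : EuclideanSpace ℝ (Fin 3)} (he : ‖e‖ = 1) (R₁ : ℝ) :
    ∃ (ψ : EuclideanSpace ℝ (Fin 3) → EuclideanSpace ℝ (Fin 3)) (L : ℝ),
      FunctionSpaces.IsTestFunctionOn (⊤ : Opens (EuclideanSpace ℝ (Fin 3))) ψ ∧
        (∀ x, ψ x ≠ 0 → R₁ < ⟪x, e⟫) ∧
        Tendsto (fun t => ∫ x, ⟪u t x, curl ψ x⟫) (𝓝[<] 0) (𝓝 L) ∧ L ≠ 0 := by
  refine exists_halfSpace_trace_curl_ne_zero_of_ne_zero hu hlaw ?_ he R₁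
  obtain ⟨t, ht, x, -, hM⟩ := hsing 1 one_pos 0
  exact ⟨t, ht.2, x, fun h0 => by rw [h0, norm_zero] at hM; exact lt_irrefl _ hM⟩

/-- **PORTRAIT ENTRY (stub `stub_envelopeCriticalLiouville`): the final-time vorticity of every
SINGULAR member accumulates at the apex** — in every punctured ball `B(0, r) ∖ {0}` some test field
`ψ` has `T_u(∇ ∧ ψ) ≠ 0`. -/
theorem exists_apex_trace_curl_ne_zero_of_singular (hu : IsTypeIAncientMild C u)
    (hlaw : ∀ s : ℝ, s < 0 → ∫⁻ x, ‖fderiv ℝ (u s) x‖ₑ ^ 2 ≤ ENNReal.ofReal (K / Real.sqrt (-s)))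
    (hsing : ∀ r > 0, ∀ M : ℝ, ∃ t ∈ Set.Ioo (-(r ^ 2)) (0 : ℝ),
        ∃ x ∈ Metric.ball (0 : EuclideanSpace ℝ (Fin 3)) r, M < ‖u t x‖) {r : ℝ} (hr : 0 < r) :
    ∃ (ψ : EuclideanSpace ℝ (Fin 3) → EuclideanSpace ℝ (Fin 3)) (L : ℝ),
      FunctionSpaces.IsTestFunctionOn (⊤ : Opens (EuclideanSpace ℝ (Fin 3))) ψ ∧
        (∀ x, ψ x ≠ 0 → x ≠ 0 ∧ ‖x‖ < r) ∧
        Tendsto (fun t => ∫ x, ⟪u t x, curl ψ x⟫) (𝓝[<] 0) (𝓝 L) ∧ L ≠ 0 := by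
  by_contra hno
  push Not at hno
  refine not_singular_of_trace_irrotational_near_apex hu hlaw hr (fun ψ hψ hsupp => ?_) hsing
  have hψ1 : ContDiff ℝ ((⊤ : ℕ∞) + 1) ψ := by simpa using hψ.contDiff
  have hcψ : FunctionSpaces.IsTestFunctionOn (⊤ : Opens (EuclideanSpace ℝ (Fin 3))) (curl ψ) :=
    ⟨contDiff_curl hψ1, hasCompactSupport_curl hψ.hasCompactSupport, fun y _ => Opens.mem_top y⟩
  obtain ⟨L, hL⟩ := exists_tendsto_pairing_finalSlice hu hlaw hcψ
  have hL0 : L = 0 := hno ψ L hψ hsupp hL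
  rwa [hL0] at hL

/-- **The crux ⟺ its restriction to members whose final datum is rotational in every half-space
and in every punctured ball around the apex.** -/
theorem finiteDissipationLiouville_iff_rotationalTrace :
    Summit.NavierStokesRegularity.NavierStokesRegularity.Theses.LerayQuarterDissipation.FiniteDissipationLiouville ↔
      ∀ (C K : ℝ) (u : ℝ → EuclideanSpace ℝ (Fin 3) → EuclideanSpace ℝ (Fin 3)),
        IsTypeIAncientMild C u →
        (∀ s : ℝ, s < 0 → ∫⁻ x, ‖fderiv ℝ (u s) x‖ₑ ^ 2 ≤ ENNReal.ofReal (K / Real.sqrt (-s))) →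
        (∀ e : EuclideanSpace ℝ (Fin 3), ‖e‖ = 1 → ∀ R₁ : ℝ,
          ∃ (ψ : EuclideanSpace ℝ (Fin 3) → EuclideanSpace ℝ (Fin 3)) (L : ℝ),
            FunctionSpaces.IsTestFunctionOn (⊤ : Opens (EuclideanSpace ℝ (Fin 3))) ψ ∧
              (∀ x, ψ x ≠ 0 → R₁ < ⟪x, e⟫) ∧
              Tendsto (fun t => ∫ x, ⟪u t x, curl ψ x⟫) (𝓝[<] 0) (𝓝 L) ∧ L ≠ 0) →
        (∀ r > 0, ∃ (ψ : EuclideanSpace ℝ (Fin 3) → EuclideanSpace ℝ (Fin 3)) (L : ℝ),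
            FunctionSpaces.IsTestFunctionOn (⊤ : Opens (EuclideanSpace ℝ (Fin 3))) ψ ∧
              (∀ x, ψ x ≠ 0 → x ≠ 0 ∧ ‖x‖ < r) ∧
              Tendsto (fun t => ∫ x, ⟪u t x, curl ψ x⟫) (𝓝[<] 0) (𝓝 L) ∧ L ≠ 0) →
        ¬ (∀ r > 0, ∀ M : ℝ, ∃ t ∈ Set.Ioo (-(r ^ 2)) (0 : ℝ),
            ∃ x ∈ Metric.ball (0 : EuclideanSpace ℝ (Fin 3)) r, M < ‖u t x‖) := by
  unfold Summit.NavierStokesRegularity.NavierStokesRegularity.Theses.LerayQuarterDissipation.FiniteDissipationLiouville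
  constructor
  · intro h C K u hu hlaw _ _
    exact h C K u hu hlaw
  · intro h C K u hu hlaw hsing
    exact h C K u hu hlaw
      (fun e he R₁ => exists_halfSpace_trace_curl_ne_zero_of_singular hu hlaw hsing he R₁)
      (fun r hr => exists_apex_trace_curl_ne_zero_of_singular hu hlaw hsing hr) hsing

end Summit.NavierStokesRegularity.NavierStokesRegularity.Theorems.FiniteDissipationLiouville.Birth.Apex

end
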